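import Mathlib
import HarnessLib
import Summits.ResolutionOfSingularities.ResolutionOfSingularities.Theorems.WildQuotientsWildQuotientResolutionAffineQuotientModelTransfer
import Literature.AlgebraicGeometry.Resolution.BlowupsEquivariant
import Literature.AlgebraicGeometry.Resolution.AffineBlowupIntegral
import Literature.AlgebraicGeometry.Resolution.AffineBlowup

/-!
# G2b — the equivariant-model transfer for the BLOW-UP model `V = Bl_I 𝔸ⁿ` with the lifted action

(crux stmt-ResolutionOfSingularities-15640 `WildQuotients.WildQuotientResolution`, line `Sketch`;
infrastructure for ALL finite groups — the `affineBlowup` instance of G2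
`AffineQuotient.hasResolution_mvPolynomial_fixedPoints_of_model` (p547101 ✓), so that the specimen finals
(ℤ9 Z5/Z6 of res-L1-w45c-idea-2's `Z9-SPECIMEN.md` §4 «Z5 quotient model = stub-3», card O's O8/O9, N4a-type
rungs) replace the model prologue `V := affineBlowup I, π, proper, birational, integral, ρB := liftAction,
hequiv` by ONE name. [OURS · L1 W4.5c] — NOT a statement of any manuscript; replaces the role of no printed
item. Def-free. Prover res-L1-w45c-stub-3.)

For a finite subgroup `G ≤ Aut_k k[x₁,…,xₙ]` (`0 < n`), the affine action `ρ` on `𝔸ⁿ` with the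
affine-quotient law, a NONZERO ideal `I ⊆ k[x]` whose blow-up centre is `G`-stable (`hJ`), and the lifted
action `ρB` on `V := Bl_I 𝔸ⁿ` over `𝔸ⁿ/G = Spec k[x]^G` (`IsBlowup.liftAction`; the binder
`hρB : ρB.aut = liftAction ρ hJ` is the N4a-scaffold convention): if `V` is covered by `G`-stable affine
opens and the glued quotient `V/G = ρB.glued` has a resolution, then `Spec k[x]^G` has a resolution
(`hasResolution_mvPolynomial_fixedPoints_of_liftAction_glued`; cyclic letters
`hasResolution_mvPolynomial_fixedPoints_zpowers_of_liftAction_glued`). Also the canonical `ρB`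
(`liftActionOver`, as an existence statement `exists_actionOver_liftAction`, so no `def` is introduced).
-/

-- single-problem summit: the doubled namespace component `ResolutionOfSingularities` is forced
set_option linter.dupNamespace false

noncomputable section

open CategoryTheory Limits AlgebraicGeometry TopologicalSpace
open scoped Pointwise
open Literature.AlgebraicGeometry.Resolution Literature.AlgebraicGeometry.RelativeSpec

namespace Summit.ResolutionOfSingularities.ResolutionOfSingularities.Theorems.WildQuotientResolution.AffineQuotient

/-- **The lifted action is an action over `Spec k[x]^G`** (existence form of the N4a-scaffold term
`⟨liftAction ρ hJ, …⟩`): there is `ρB : ActionOver (π ≫ q) G` with `ρB.aut = liftAction ρ hJ`, where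
`q : 𝔸ⁿ → 𝔸ⁿ/G` is `Spec` of the inclusion of invariants. [folklore] -/
theorem exists_actionOver_liftAction (k : Type) [Field k] {B : Type} [CommRing B] [Algebra k B]
    (G : Type) [Group G] [MulSemiringAction G B] [SMulCommClass G k B]
    (ρ : G →* Aut (Spec (CommRingCat.of B)))
    (hρ : ∀ g : G, (ρ g).hom = Spec.map (CommRingCat.ofHom
      ((MulSemiringAction.toRingEquiv G B g⁻¹ : B ≃+* B) : B →+* B)))
    {V : Scheme.{0}} {π : V ⟶ Spec (CommRingCat.of B)}
    {J : (Spec (CommRingCat.of B)).IdealSheafData} (hπ : IsBlowup π J)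
    (hJ : ∀ g : G, J.comap (ρ g).hom = J) :
    ∃ ρB : ActionOver (π ≫ Spec.map (CommRingCat.ofHom
      (algebraMap (FixedPoints.subalgebra k B G) B))) G, ρB.aut = hπ.liftAction ρ hJ :=
  ⟨⟨hπ.liftAction ρ hJ, fun g =>
    hπ.liftAction_hom_comp_comp ρ hJ _ (fun g => specAction_comp k ρ hρ g) g⟩, rfl⟩

/-- **G2b, any finite `G ≤ Aut_k k[x]`**: for `0 < n`, the affine action `ρ` (affine-quotient law), a
nonzero ideal `I` with `G`-stable blow-up centre, and the lifted action `ρB` (`ρB.aut = liftAction ρ hJ`)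
on `V = Bl_I 𝔸ⁿ` over `Spec k[x]^G`: a `G`-stable affine cover of `V` and a resolution of `V/G = ρB.glued`
give `HasResolution (Spec k[x]^G)`. (`V` is integral, `π` proper and birational:
`affineBlowup.isIntegral/isProper/isBirational`; then G2.) [OURS · L1 W4.5c] [folklore] -/
theorem hasResolution_mvPolynomial_fixedPoints_of_liftAction_glued (k : Type) [Field k] (n : ℕ)
    (hn : 0 < n) (G : Subgroup (MvPolynomial (Fin n) k ≃ₐ[k] MvPolynomial (Fin n) k)) [Finite G]
    (ρ : G →* Aut (Spec (CommRingCat.of (MvPolynomial (Fin n) k))))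
    (hρ : ∀ g : G, (ρ g).hom = Spec.map (CommRingCat.ofHom
      ((MulSemiringAction.toRingEquiv G (MvPolynomial (Fin n) k) g⁻¹ :
        MvPolynomial (Fin n) k ≃+* MvPolynomial (Fin n) k) :
          MvPolynomial (Fin n) k →+* MvPolynomial (Fin n) k)))
    (I : Ideal (MvPolynomial (Fin n) k)) (hI : I ≠ ⊥)
    (hJ : ∀ g : G, (affineBlowup.idealSheaf I).comap (ρ g).hom = affineBlowup.idealSheaf I)
    (ρB : ActionOver (affineBlowup.π I ≫ Spec.map (CommRingCat.ofHom
      (algebraMap (FixedPoints.subalgebra k (MvPolynomial (Fin n) k) G) (MvPolynomial (Fin n) k)))) G)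
    (hρB : ρB.aut = (affineBlowup.isBlowup I).liftAction ρ hJ)
    (hcov : ∀ v : ↥(affineBlowup I), ∃ O : ρB.StableAffineOpens, v ∈ O.1)
    (hres : Scheme.HasResolution ρB.glued) :
    Scheme.HasResolution
      (Spec (CommRingCat.of (FixedPoints.subalgebra k (MvPolynomial (Fin n) k) G))) := by
  haveI : IsIntegral (affineBlowup I) := affineBlowup.isIntegral hI
  have hequiv : ∀ g : G, (ρB.aut g).hom ≫ affineBlowup.π I = affineBlowup.π I ≫ (ρ g).hom := by
    intro g
    rw [hρB]
    exact (affineBlowup.isBlowup I).liftAction_hom_comp ρ hJ g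
  exact hasResolution_mvPolynomial_fixedPoints_of_model k n hn G ρ hρ (affineBlowup I)
    (affineBlowup.π I) (affineBlowup.isBirational hI) ρB hequiv hcov hres

/-- **G2b, cyclic letters** (`G = zpowers σ`, binder order of G2's
`hasResolution_mvPolynomial_fixedPoints_zpowers_of_model`). [OURS · L1 W4.5c] [folklore] -/
theorem hasResolution_mvPolynomial_fixedPoints_zpowers_of_liftAction_glued (k : Type) [Field k] (n : ℕ)
    (σ : MvPolynomial (Fin n) k ≃ₐ[k] MvPolynomial (Fin n) k) [Finite ↥(Subgroup.zpowers σ)]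
    (hn : 0 < n)
    (ρ : ↥(Subgroup.zpowers σ) →* Aut (Spec (CommRingCat.of (MvPolynomial (Fin n) k))))
    (hρ : ∀ g : ↥(Subgroup.zpowers σ), (ρ g).hom = Spec.map (CommRingCat.ofHom
      ((MulSemiringAction.toRingEquiv (↥(Subgroup.zpowers σ)) (MvPolynomial (Fin n) k) g⁻¹ :
        MvPolynomial (Fin n) k ≃+* MvPolynomial (Fin n) k) :
          MvPolynomial (Fin n) k →+* MvPolynomial (Fin n) k)))
    (I : Ideal (MvPolynomial (Fin n) k)) (hI : I ≠ ⊥)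
    (hJ : ∀ g : ↥(Subgroup.zpowers σ),
      (affineBlowup.idealSheaf I).comap (ρ g).hom = affineBlowup.idealSheaf I)
    (ρB : ActionOver (affineBlowup.π I ≫ Spec.map (CommRingCat.ofHom
      (algebraMap (FixedPoints.subalgebra k (MvPolynomial (Fin n) k) ↥(Subgroup.zpowers σ))
        (MvPolynomial (Fin n) k)))) ↥(Subgroup.zpowers σ))
    (hρB : ρB.aut = (affineBlowup.isBlowup I).liftAction ρ hJ)
    (hcov : ∀ v : ↥(affineBlowup I), ∃ O : ρB.StableAffineOpens, v ∈ O.1)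
    (hres : Scheme.HasResolution ρB.glued) :
    Scheme.HasResolution (Spec (CommRingCat.of
      (FixedPoints.subalgebra k (MvPolynomial (Fin n) k) ↥(Subgroup.zpowers σ)))) :=
  hasResolution_mvPolynomial_fixedPoints_of_liftAction_glued k n hn (Subgroup.zpowers σ) ρ hρ I hI hJ
    ρB hρB hcov hres

end Summit.ResolutionOfSingularities.ResolutionOfSingularities.Theorems.WildQuotientResolution.AffineQuotient

end
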